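import Literature.NumberTheory.Automorphic.ArithmeticQuotientHeckeLocal
import HarnessLib

/-!
# Hecke operators of a representation at an unramified level: local sums, level independence,
# transport along injective homomorphisms

Topic `NumberTheory/Automorphic`; namespaces `Literature.NumberTheory.Automorphic.ArithmeticQuotient.IsUnramifiedLevel`
and `Literature.NumberTheory.Automorphic` (section `Transport`).  Theorems only (no definition, no
named fact), complementing `ArithmeticQuotientHeckeLocal` (which treats the Hecke operators
`heckeFun` on functions on `𝒢 ⧸ L`) for the Hecke operators `heckeOperator ρ L g = ∑_{yL ⊆ LgL} ρ(y)`
of `HeckeAlgebra` on an ARBITRARY representation `ρ` of `𝒢`: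

* `IsUnramifiedLevel.bijOn_image` — a transversal `s` of the local double coset `Kᵥ a Kᵥ / Kᵥ`
  maps under `ιᵥ` to a transversal of `L ιᵥ(a) L / L` (the local–global coset correspondence
  `bijOn_localCoset` of `ArithmeticQuotientHeckeLocal`);
* `IsUnramifiedLevel.heckeOperator_apply_eq_sum_local` — **`[L ιᵥ(a) L] v = ∑_{y ∈ s} ρ(ιᵥ y) v`**
  for `v ∈ V^L`: at an unramified level the global Hecke operator is the local double-coset sum
  ([KhareThorne2017, §6.2]: "the algebra `ℋ(G(F_v), U_v)` acts"; Bump 1997, §3.3);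
* `IsUnramifiedLevel.heckeOperator_apply_eq_of_isUnramifiedLevel` — **independence of the level**:
  two levels unramified at the same place give the same operator `[· ιᵥ(a) ·]` on vectors fixed by
  both (e.g. an open compact `U ≤ GL_n(𝔸_K^∞)` and the finite part of a principal congruence
  subgroup `K(𝔫) ≤ U` at the cofinitely many places where both are unramified,
  `BigHeckeGLn.exists_goodPlaces`, `isUnramifiedLevel_comap_principalCongruenceLevel`);
* `heckeOperator_comp_apply` — **transport**: for an injective `f : G' →* G`,
  `heckeOperator (ρ ∘ f) U g v = heckeOperator ρ (f(U)) (f g) v` on `U`-fixed `v` (e.g. along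
  `GLn.ofFinite : GL_n(𝔸_K^∞) → GL_n(𝔸_K)`, relating finite-adelic levels to the tree's adelic
  `principalCongruenceLevel`), with `mem_fixedPoints_comp_iff_map`, `bijOn_image_of_injective`,
  and `IsUnramifiedLevel.exists_transversal` (a transversal of a finite `Kᵥ a Kᵥ / Kᵥ`).

These are the level-change inputs for comparing the Hecke operators `T_{w,j} = [U t_{w,j} U]` on
the cohomology of a level `U` with the operators `[K(𝔫) t_{w,j}(ϖ) K(𝔫)]` on automorphic forms
(Eichler–Shimura–Harder comparison, Harder 1987, §3).

## References
* C. Khare, J. Thorne, Amer. J. Math. 139 (2017), §6.2 [KhareThorne2017].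
* D. Bump, *Automorphic forms and representations* (1997), §3.3 [Bump1997].
-/

noncomputable section

open MulAction

namespace Literature.NumberTheory.Automorphic

namespace ArithmeticQuotient

namespace IsUnramifiedLevel

universe u

variable {k : Type*} [CommRing k] {𝒢 : Type u} [Group 𝒢] {Gᵥ : Type*} [Group Gᵥ]
  {Kᵥ : Subgroup Gᵥ} {ιᵥ : Gᵥ →* 𝒢} {πᵥ : 𝒢 →* Gᵥ} {L L₁ L₂ : Subgroup 𝒢}
  {V : Type*} [AddCommGroup V] [Module k V] (ρ : Representation k 𝒢 V)

/-- `ιᵥ` is injective (it has the retraction `πᵥ`). [folklore] -/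
theorem map_injective (h : IsUnramifiedLevel Kᵥ ιᵥ πᵥ L) : Function.Injective ιᵥ :=
  fun x y hxy => by simpa only [h.apply_apply] using congrArg πᵥ hxy

/-- A local transversal maps to a global one: if `s ⊆ Gᵥ` is a transversal of `Kᵥ a Kᵥ / Kᵥ`
then `ιᵥ(s)` is a transversal of `L ιᵥ(a) L / L`. [cite: KhareThorne2017, §6.2] -/
theorem bijOn_image (h : IsUnramifiedLevel Kᵥ ιᵥ πᵥ L) (a : Gᵥ) (s : Finset Gᵥ)
    (hs : Set.BijOn (fun y : Gᵥ => (y : Gᵥ ⧸ Kᵥ)) s (orbit Kᵥ (a : Gᵥ ⧸ Kᵥ))) :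
    Set.BijOn (fun x : 𝒢 => (x : 𝒢 ⧸ L)) (ιᵥ '' (s : Set Gᵥ))
      (orbit L ((ιᵥ a : 𝒢) : 𝒢 ⧸ L)) := by
  have hb : Set.BijOn (fun y : Gᵥ => ((ιᵥ y : 𝒢) : 𝒢 ⧸ L)) s (doubleCosetQuot L (ιᵥ a)) := by
    have hc := (h.bijOn_localCoset a).comp hs
    refine hc.congr fun y _ => ?_
    simp only [Function.comp_apply, localCoset_mk]
  refine ⟨?_, ?_, ?_⟩
  · rintro _ ⟨y, hy, rfl⟩
    exact hb.mapsTo hy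
  · rintro _ ⟨y₁, hy₁, rfl⟩ _ ⟨y₂, hy₂, rfl⟩ hxy
    exact congrArg ιᵥ (hb.injOn hy₁ hy₂ hxy)
  · intro c hc
    obtain ⟨y, hy, rfl⟩ := hb.surjOn hc
    exact ⟨ιᵥ y, ⟨y, hy, rfl⟩, rfl⟩

/-- **The Hecke operator at an unramified level is the local double-coset sum**: for `v ∈ V^L`
and a transversal `s` of `Kᵥ a Kᵥ / Kᵥ`, `[L ιᵥ(a) L] v = ∑_{y ∈ s} ρ(ιᵥ y) v`.
[cite: KhareThorne2017, §6.2] -/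
theorem heckeOperator_apply_eq_sum_local (h : IsUnramifiedLevel Kᵥ ιᵥ πᵥ L) (a : Gᵥ)
    (s : Finset Gᵥ) (hs : Set.BijOn (fun y : Gᵥ => (y : Gᵥ ⧸ Kᵥ)) s (orbit Kᵥ (a : Gᵥ ⧸ Kᵥ)))
    {v : V} (hv : v ∈ ρ.fixedPoints L) :
    Automorphic.heckeOperator ρ L (ιᵥ a) v = ∑ y ∈ s, ρ (ιᵥ y) v := by
  classical
  have hs' : Set.BijOn (fun x : 𝒢 => (x : 𝒢 ⧸ L)) ((s.image ιᵥ : Finset 𝒢) : Set 𝒢)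
      (orbit L ((ιᵥ a : 𝒢) : 𝒢 ⧸ L)) := by
    rw [Finset.coe_image]
    exact h.bijOn_image a s hs
  rw [heckeOperator_apply_eq_sum ρ L (ιᵥ a) (s.image ιᵥ) hs' hv,
    Finset.sum_image fun x _ y _ hxy => h.map_injective hxy]

/-- A transversal of a finite `Kᵥ a Kᵥ / Kᵥ` (representatives by `Quotient.out`). [folklore] -/
theorem exists_transversal (a : Gᵥ) (ha : (orbit Kᵥ (a : Gᵥ ⧸ Kᵥ)).Finite) :
    ∃ s : Finset Gᵥ, Set.BijOn (fun y : Gᵥ => (y : Gᵥ ⧸ Kᵥ)) s (orbit Kᵥ (a : Gᵥ ⧸ Kᵥ)) := by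
  classical
  refine ⟨ha.toFinset.image Quotient.out, ?_, ?_, ?_⟩
  · rintro _ hy
    rw [Finset.coe_image, Set.mem_image] at hy
    obtain ⟨c, hc, rfl⟩ := hy
    rw [Finset.mem_coe, Set.Finite.mem_toFinset] at hc
    dsimp only
    rwa [QuotientGroup.out_eq']
  · rintro y₁ hy₁ y₂ hy₂ hxy
    rw [Finset.coe_image, Set.mem_image] at hy₁ hy₂
    obtain ⟨c₁, -, rfl⟩ := hy₁
    obtain ⟨c₂, -, rfl⟩ := hy₂
    dsimp only at hxy
    rw [QuotientGroup.out_eq', QuotientGroup.out_eq'] at hxy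
    rw [hxy]
  · intro c hc
    refine ⟨c.out, ?_, QuotientGroup.out_eq' c⟩
    rw [Finset.coe_image, Set.mem_image]
    exact ⟨c, by rwa [Finset.mem_coe, Set.Finite.mem_toFinset], rfl⟩

/-- **Independence of the unramified level**: two levels unramified at the same place define the
same Hecke operator `[· ιᵥ(a) ·]` on vectors fixed by both (both are the local sum).
[cite: KhareThorne2017, §6.2] -/
theorem heckeOperator_apply_eq_of_isUnramifiedLevel (h₁ : IsUnramifiedLevel Kᵥ ιᵥ πᵥ L₁)
    (h₂ : IsUnramifiedLevel Kᵥ ιᵥ πᵥ L₂) (a : Gᵥ) (ha : (orbit Kᵥ (a : Gᵥ ⧸ Kᵥ)).Finite) {v : V}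
    (hv₁ : v ∈ ρ.fixedPoints L₁) (hv₂ : v ∈ ρ.fixedPoints L₂) :
    Automorphic.heckeOperator ρ L₁ (ιᵥ a) v = Automorphic.heckeOperator ρ L₂ (ιᵥ a) v := by
  obtain ⟨s, hs⟩ := exists_transversal (Kᵥ := Kᵥ) a ha
  rw [h₁.heckeOperator_apply_eq_sum_local ρ a s hs hv₁, h₂.heckeOperator_apply_eq_sum_local ρ a s hs hv₂]

end IsUnramifiedLevel

end ArithmeticQuotient

/-! ### Transport of Hecke operators along injective homomorphisms -/

section Transport

variable {k : Type*} [CommRing k] {G G' : Type*} [Group G] [Group G'] {V : Type*}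
  [AddCommGroup V] [Module k V] (ρ : Representation k G V) (f : G' →* G)

/-- Fixed vectors of the pulled-back representation. [folklore] -/
theorem mem_fixedPoints_comp_iff_map (U : Subgroup G') (v : V) :
    v ∈ Representation.fixedPoints (ρ.comp f) U ↔ v ∈ ρ.fixedPoints (U.map f) := by
  rw [Representation.mem_fixedPoints, Representation.mem_fixedPoints]
  constructor
  · rintro h _ ⟨u, hu, rfl⟩
    exact h u hu
  · intro h u hu
    exact h (f u) ⟨u, hu, rfl⟩

/-- A transversal of `U g U / U` maps under an injective `f` to a transversal of
`f(U) f(g) f(U) / f(U)`. [folklore] -/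
theorem bijOn_image_of_injective (hf : Function.Injective f) (U : Subgroup G') (g : G')
    (s : Finset G') (hs : Set.BijOn (fun y : G' => (y : G' ⧸ U)) s (orbit U (g : G' ⧸ U))) :
    Set.BijOn (fun x : G => (x : G ⧸ U.map f)) (f '' (s : Set G'))
      (orbit (U.map f) ((f g : G) : G ⧸ U.map f)) := by
  -- `f y (f U) = f y' (f U) ↔ y U = y' U`
  have hiff : ∀ y y' : G', ((f y : G) : G ⧸ U.map f) = ((f y' : G) : G ⧸ U.map f) ↔
      (y : G' ⧸ U) = (y' : G' ⧸ U) := fun y y' => by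
    rw [QuotientGroup.eq, QuotientGroup.eq, ← map_inv, ← map_mul]
    constructor
    · rintro ⟨u, hu, hfu⟩
      rwa [← hf hfu]
    · exact fun hmem => ⟨_, hmem, rfl⟩
  refine ⟨?_, ?_, ?_⟩
  · rintro _ ⟨y, hy, rfl⟩
    obtain ⟨u, hu⟩ := hs.mapsTo hy
    refine ⟨⟨f u, ⟨u, u.2, rfl⟩⟩, ?_⟩
    have hu' : ((u : G') * g : G') = (y : G' ⧸ U) := hu
    change (((f u : G) * f g : G) : G ⧸ U.map f) = ((f y : G) : G ⧸ U.map f)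
    rw [← map_mul, hiff]
    exact hu'
  · rintro _ ⟨y₁, hy₁, rfl⟩ _ ⟨y₂, hy₂, rfl⟩ hxy
    exact congrArg f (hs.injOn hy₁ hy₂ ((hiff y₁ y₂).1 hxy))
  · rintro c ⟨u, rfl⟩
    obtain ⟨u', hu', hfu'⟩ := u.2
    -- the coset `f(u') f(g) f(U)` comes from `u' g U`
    obtain ⟨y, hy, hyu⟩ := hs.surjOn (Set.mem_range.2 ⟨⟨u', hu'⟩, rfl⟩ :
      ((u' * g : G') : G' ⧸ U) ∈ orbit U (g : G' ⧸ U))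
    refine ⟨f y, ⟨y, hy, rfl⟩, ?_⟩
    have hyu' : (y : G' ⧸ U) = ((u' * g : G') : G' ⧸ U) := hyu
    change ((f y : G) : G ⧸ U.map f) = (((u : G) * f g : G) : G ⧸ U.map f)
    rw [← hfu', ← map_mul, hiff]
    exact hyu'

/-- **Transport of Hecke operators**: for an injective `f : G' → G`, the Hecke operator of the
pulled-back representation `ρ ∘ f` at level `U` and element `g` is the Hecke operator of `ρ` at
level `f(U)` and element `f(g)`, on `U`-fixed vectors (finite double coset). [folklore] -/
theorem heckeOperator_comp_apply (hf : Function.Injective f) (U : Subgroup G') (g : G')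
    (hfin : (orbit U (g : G' ⧸ U)).Finite) {v : V}
    (hv : v ∈ Representation.fixedPoints (ρ.comp f) U) :
    heckeOperator (ρ.comp f) U g v = heckeOperator ρ (U.map f) (f g) v := by
  classical
  obtain ⟨s, hs⟩ := ArithmeticQuotient.IsUnramifiedLevel.exists_transversal (Kᵥ := U) g hfin
  have hv' : v ∈ ρ.fixedPoints (U.map f) := (mem_fixedPoints_comp_iff_map ρ f U v).1 hv
  have hs' : Set.BijOn (fun x : G => (x : G ⧸ U.map f)) ((s.image f : Finset G) : Set G)
      (orbit (U.map f) ((f g : G) : G ⧸ U.map f)) := by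
    rw [Finset.coe_image]
    exact bijOn_image_of_injective f hf U g s hs
  rw [heckeOperator_apply_eq_sum _ U g s hs hv, heckeOperator_apply_eq_sum ρ _ (f g) (s.image f) hs' hv',
    Finset.sum_image fun x _ y _ hxy => hf hxy]
  rfl

end Transport

end Literature.NumberTheory.Automorphic

end
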